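import Literature.MathematicalPhysics.QuantumFieldTheory.BalabanImbrieJaffe1984to88.BIJ88Ineq5144Located
import Literature.MathematicalPhysics.QuantumFieldTheory.BalabanImbrieJaffe1984to88.BIJ88W6PrimeVsupp

/-!
# `BalabanImbrieJaffe1984to88.BIJ88Ineq5144LocatedWitness` — T. Bałaban, J. Imbrie, A. Jaffe, *Effective action and cluster properties of the
abelian Higgs model*, Commun. Math. Phys. **114** (1988) 257–315 [BalabanImbrieJaffe1988], Sect. 5.14, (5.14.4) p. 309 [PDF 53]: **NON-VACUITY OF
THE LOCATED READING OF THE LEAF (5.14.4) ON §5.13 GAUSSIAN DATA, AND FAILURE OF THE UNLOCATED ONE ON THE SAME DATA** (GAPS G-C2-p36-07).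

statement-level skeleton of published theorems with citation tags; proofs where landed; nothing here is a claim about the Yang–Mills mass gap

THE DATA (a legal instance of the §5.13 model of gens 8–13: finitely many sites, cube map `blk`, a block-diagonal positive-definite precision `Δ` —
no inter-cube coupling, so `Δ` couples abutting cubes only for EVERY abutting relation —, source `ℱ`, NO χ-slots (`B = ∅`) and ONE interaction slot
per cube (`Ys = univ`, `cube (inr Y) = Y`) with the constant small interaction `V(Y) ≡ v`, `0 ≤ v ≤ θ`): for the located data of every region `X`
at every corner `Λ`, every `t ∈ [0,1]` and every assignment `γ` of derivative labels,
* **`ineq5144_locAct_witness`** — THE LEAF BY NAME IN THE LOCATED READING HOLDS: `Ineq5144 (cubeSys I) (Finset L) (locAct (cubeIn cube X ∘ γ)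
  (actIn … X t γ)) card (H X″ ↦ |X″ ∖ (cubeIn X ∘ γ) H|) θ β′` (`0 < θ ≤ 1`, `β′ ≤ 1`): polymers with `≥ 2` cubes have activity `0` (the corner
  expectations of block-diagonal data do not depend on the corner: `zG_corner_indep`, `cornerSum_const_eq_zero`), the one-cube activities are
  `(−v)^m e^{−tv} − [m = 0]` with `m` = the number of derivatives on the cube's slot (`zG_singleton_eq`), bounded by `θ^m` resp. `θ^{β′}`;
* **`not_ineq5144_unlocated_witness`** — THE UNLOCATED INSTANTIATION OF RECORD FAILS on the same data (region `{i₀}`, any `γ`) for `θ < 1` as soon as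
  there are a label and a second cube (`BIJ88Ineq5144Located.not_ineq5144_unlocated`: the undecorated expectation of a cube outside the region is `1`).
So the located leaf — the hypothesis of the repaired chain `BIJ88SlotConnectedGraph310KPLoc` / `BIJ88W6PrimeVsuppLoc` / `BIJ88Eq5145CornerW6Loc` — is a
genuine, satisfiable hypothesis on the data, while the unlocated one (the hypothesis of the landed gen 11–13 chain) is not.

PDF held: `paper:balaban1988-cmp114-bij-abelian-higgs-effective-action` (journal page = PDF page + 256); p. 309 = PDF 53 read this session:
*"Here H_β ⊂ H specifies which (d/dt)_{γ_j} have supports intersecting X_β. … |g₃(H_β, X_β)| ≤ (e^β(L^kε/ε₀)^{1/4−α})^{[|H_β| + β′|X_β∖H_β|]}. (5.14.4)"*.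
HONEST SCOPE: a degenerate but legal instance (no χ-fields, constant interaction, no inter-cube coupling) — a satisfiability witness, not a step of the
paper's proof of (5.14.4); (5.14.4) for the paper's data is NOT proved.  0 `sorry`, 1 auxiliary definition (`slotAt`, the interaction slot of a
cube of the region), 0 `Prop` facts (D-0026); imports
`BIJ88Ineq5144Located` (p36 g14), `BIJ88W6PrimeVsupp` (p36 g13).  NOT summit progress; NOT continuum; NOT Clay.  Cell `lit-balaban` Phase 2, seat p36
gen 14 (row C2.Eq5.14.3-5.14.4 member cell, owner r16, referee ref-5; GAPS G-C2-p36-07).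
-/

noncomputable section

open Finset MeasureTheory
open Literature.MathematicalPhysics.QuantumFieldTheory.BalabanImbrieJaffe1984to88
open BIJ88DirichletForms305 (interpForm interpForm_apply)
open BIJ88Clusters5134 (cornerSum act cornerSum_eq_of_forall_sum)
open BIJ88PolymerRep5134 (g1 g1_singleton g1_empty g1_of_two_le corner IsConn)
open BIJ88PolymerRep5134Gauss (ext obs prec zG)
open BIJ88Expansion5143 (g3 prime prime_of_not)
open BIJ88Expansion5143Gauss (fD fD_slot isSlotLocal_zG)
open BIJ88SlotMoments308 (slotFactor slotFactor_inr)
open BIJ88SlotMomentsGauss308 (uD)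
open BIJ88Sect5Statements (CutoffProfile)
open BIJ88Sect5StatementsPart2 (Ineq5144)
open BIJ88Ineq5113Covering (cubeSys)
open BIJ88Eq5145CornerModel (slotB slotY mem_slotB mem_slotY regionLaw zG_eq_integral_regionLaw isProbabilityMeasure_regionLaw)
open BIJ88Eq5145CornerUrsell (cubeIn cubeIn_mem)
open BIJ88W6PrimeVsupp (actIn)
open BIJ88Ineq5144Located (locAct ineq5144_locAct_iff not_ineq5144_unlocated)

namespace Literature.MathematicalPhysics.QuantumFieldTheory.BalabanImbrieJaffe1984to88.BIJ88Ineq5144LocatedWitness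

/-! ## §1 Block-diagonal data: the corner expectations do not see the corner; polymers with two cubes have activity `0` -/

section BlockDiag

variable {α I : Type} [Fintype α] [DecidableEq α] [Fintype I] [DecidableEq I]
  (blk : α → I) {Δ : Matrix α α ℝ} (ℱ : α → ℝ) (f : I → (α → ℝ) → ℝ)

/-- a block-diagonal precision (no inter-cube coupling) is its own interpolation at every corner (p. 305: `□_iΔ_s□_{i′} = s_is_{i′}□_iΔ□_{i′}`
vanishes when `□_iΔ□_{i′} = 0`). [cite: BalabanImbrieJaffe1988, p.305 (Sect. 5.13)] -/
theorem interpForm_eq_self (hΔ0 : ∀ x y, blk x ≠ blk y → Δ x y = 0) (s : I → ℝ) : interpForm blk Δ s = Δ := by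
  ext x y
  rw [interpForm_apply]
  split_ifs with h
  · rfl
  · rw [hΔ0 x y h, mul_zero]

/-- **for block-diagonal data the corner expectations do not depend on the corner.** [cite: BalabanImbrieJaffe1988, p.306 (Sect. 5.13)] -/
theorem zG_corner_indep (hΔ0 : ∀ x y, blk x ≠ blk y → Δ x y = 0) (X S T : Finset I) : zG blk Δ ℱ f X S = zG blk Δ ℱ f X T := by
  simp only [zG, BIJ88PolymerRep5134Gauss.expect, prec, interpForm_eq_self blk hΔ0]

omit [Fintype I] in
/-- the corner sum of a constant over a nonempty coordinate set vanishes (`∫ds_Γ ∂_Γ` of a constant). [cite: BalabanImbrieJaffe1988, (5.13.3) p.305] -/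
theorem cornerSum_const_eq_zero (a : ℝ) {Γ : Finset I} (hΓ : Γ.Nonempty) : cornerSum (fun _ : Finset I => a) Γ = 0 := by
  have h := cornerSum_eq_of_forall_sum (F := fun _ : Finset I => a) (J := fun Γ' : Finset I => if Γ' = ∅ then a else 0) (W := Γ)
    (fun Γ' _ => by rw [sum_ite_eq' Γ'.powerset ∅, if_pos (empty_mem_powerset Γ')]) Γ Subset.rfl
  rw [h, if_neg hΓ.ne_empty]

/-- **for block-diagonal data every polymer with at least two cubes has activity `0`** (its `g₁` is a corner sum of a corner-independent
expectation) — whatever the abutting relation. [cite: BalabanImbrieJaffe1988, p.306 (Sect. 5.13)] -/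
theorem g1_eq_zero_of_two_le (adj : I → I → Prop) [DecidableRel adj] (hΔ0 : ∀ x y, blk x ≠ blk y → Δ x y = 0) {X : Finset I}
    (h2 : 2 ≤ X.card) : g1 adj (zG blk Δ ℱ f) X = 0 := by
  rw [g1_of_two_le adj _ h2]
  split_ifs
  · have hc : (zG blk Δ ℱ f X) = fun _ => zG blk Δ ℱ f X X := funext fun S => zG_corner_indep blk ℱ f hΔ0 X S X
    rw [act, hc]
    exact cornerSum_const_eq_zero _ (card_pos.1 (by omega))
  · rfl

end BlockDiag

/-! ## §2 The data: no χ-slots, one constant interaction slot per cube -/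

section Data

variable {α I : Type} [Fintype α] [DecidableEq α] [Fintype I] [DecidableEq I]
  (blk : α → I) {Δ : Matrix α α ℝ} (ℱ : α → ℝ) (adj : I → I → Prop) [DecidableRel adj]
  (χ : CutoffProfile) {ι : Type*} [DecidableEq ι] (p ek : ℝ) (Φ : ι → (α → ℝ) → ℝ) (c : ι → ℝ) (v : ℝ)
  (cube : ↥(∅ : Finset ι) ⊕ ↥(univ : Finset I) → I)

/-- the interaction slot of the cube `i` located in a region containing it. [cite: BalabanImbrieJaffe1988, (5.14.2) p.308] -/
def slotAt (hcube : ∀ Y, cube (Sum.inr Y) = Y.1) {X : Finset I} {i : I} (hi : i ∈ X) :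
    ↥(slotB (∅ : Finset ι) (univ : Finset I) cube X) ⊕ ↥(slotY (∅ : Finset ι) (univ : Finset I) cube X) :=
  Sum.inr ⟨⟨i, mem_univ i⟩, (mem_slotY _ _ cube X _).2 (by rw [hcube]; exact hi)⟩

variable {cube}

omit [Fintype α] [DecidableEq α] [DecidableEq ι] in
/-- the interaction slots of equal cubes are equal. [cite: BalabanImbrieJaffe1988, (5.14.2) p.308] -/
theorem slotAt_congr (hcube : ∀ Y, cube (Sum.inr Y) = Y.1) {X : Finset I} {i i' : I} (hi : i ∈ X) (hi' : i' ∈ X) (h : i = i') :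
    slotAt cube hcube hi = slotAt cube hcube hi' := by
  subst h; rfl

omit [Fintype α] [DecidableEq α] [DecidableEq ι] in
/-- every located slot of the data is the interaction slot of its cube. [cite: BalabanImbrieJaffe1988, (5.14.2) p.308] -/
theorem eq_slotAt (hcube : ∀ Y, cube (Sum.inr Y) = Y.1) {X : Finset I}
    (τ : ↥(slotB (∅ : Finset ι) (univ : Finset I) cube X) ⊕ ↥(slotY (∅ : Finset ι) (univ : Finset I) cube X)) :
    τ = slotAt cube hcube (cubeIn_mem cube X τ) := by
  rcases τ with b | Y
  · exact absurd b.1.2 (notMem_empty _)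
  · simp only [slotAt, Sum.inr.injEq]
    apply Subtype.ext; apply Subtype.ext
    show Y.1.1 = cubeIn cube X (Sum.inr Y)
    simp only [cubeIn, Sum.elim_inr, hcube]

omit [Fintype α] [DecidableEq α] [DecidableEq ι] in
/-- the cube of the interaction slot. [cite: BalabanImbrieJaffe1988, (5.14.2) p.308] -/
@[simp] theorem cubeIn_slotAt (hcube : ∀ Y, cube (Sum.inr Y) = Y.1) {X : Finset I} {i : I} (hi : i ∈ X) :
    cubeIn cube X (slotAt cube hcube hi) = i := by
  simp only [cubeIn, slotAt, Sum.elim_inr, hcube]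

omit [Fintype α] [DecidableEq α] [DecidableEq ι] in
/-- the located slots sitting in the cube `i`: none if `i ∉ X`, exactly the interaction slot of `i` if `i ∈ X`. [cite: BalabanImbrieJaffe1988, (5.14.2) p.308] -/
theorem filter_cubeIn_eq (hcube : ∀ Y, cube (Sum.inr Y) = Y.1) (X : Finset I) (i : I) :
    (univ.filter fun τ : ↥(slotB (∅ : Finset ι) (univ : Finset I) cube X) ⊕ ↥(slotY (∅ : Finset ι) (univ : Finset I) cube X) =>
      cubeIn cube X τ = i) = if hi : i ∈ X then {slotAt cube hcube hi} else ∅ := by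
  split_ifs with hi
  · ext τ
    simp only [mem_filter, mem_univ, true_and, mem_singleton]
    constructor
    · intro hτ
      exact (eq_slotAt hcube τ).trans (slotAt_congr hcube _ hi hτ)
    · rintro rfl; exact cubeIn_slotAt hcube hi
  · exact filter_eq_empty_iff.2 fun τ _ hτ => hi (hτ ▸ cubeIn_mem cube X τ)

omit [Fintype α] [DecidableEq α] [DecidableEq ι] in
/-- **the derivative factors of the constant interaction slot**: `(d/ds)^m e^{−sv} |_{s=t} = (−v)^m e^{−tv}`.
[cite: BalabanImbrieJaffe1988, (5.14.2) p.308] -/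
theorem uD_slotAt (hcube : ∀ Y, cube (Sum.inr Y) = Y.1) {X : Finset I} {i : I} (hi : i ∈ X) (t : ℝ) (m : ℕ) (φ : α → ℝ) :
    uD χ p ek (slotB (∅ : Finset ι) (univ : Finset I) cube X) (fun b : ↥(∅ : Finset ι) => Φ b) (fun b : ↥(∅ : Finset ι) => c b)
        (slotY (∅ : Finset ι) (univ : Finset I) cube X) (fun _ : ↥(univ : Finset I) => fun _ : α → ℝ => v) t (slotAt cube hcube hi) m φ =
      (-v) ^ m * Real.exp (-(t * v)) := by
  simp only [uD, slotAt, slotFactor_inr]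
  have h : (fun s : ℝ => Real.exp (-(s * v))) = fun s => Real.exp (-v * s) := funext fun s => by ring_nf
  rw [h, iteratedDeriv_exp_const_mul]
  ring_nf

/-- **the one-cube corner expectations of the data**: for located labels (every label of `H` on a slot of cube `i ∈ X`) the expectation over
`□_i` of the derivative observable is `(−v)^{|H|} e^{−tv}` (a constant integrand under a probability law; `Δ ≻ 0` block-diagonal).
[cite: BalabanImbrieJaffe1988, (5.14.3) p.309] -/
theorem zG_singleton_eq (hΔ0 : ∀ x y, blk x ≠ blk y → Δ x y = 0) (hΔ : Δ.PosDef) (hcube : ∀ Y, cube (Sum.inr Y) = Y.1) (Λ X : Finset I)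
    {i : I} (hi : i ∈ X) (t : ℝ) {L : Type} [DecidableEq L]
    (γ : L → ↥(slotB (∅ : Finset ι) (univ : Finset I) cube X) ⊕ ↥(slotY (∅ : Finset ι) (univ : Finset I) cube X)) (H : Finset L)
    (hH : ∀ j ∈ H, cubeIn cube X (γ j) = i) :
    zG blk (interpForm blk Δ (corner ℝ Λ)) ℱ (fD (uD χ p ek (slotB (∅ : Finset ι) (univ : Finset I) cube X) (fun b : ↥(∅ : Finset ι) => Φ b)
        (fun b : ↥(∅ : Finset ι) => c b) (slotY (∅ : Finset ι) (univ : Finset I) cube X) (fun _ : ↥(univ : Finset I) => fun _ : α → ℝ => v) t)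
        (cubeIn cube X) γ H) {i} {i} = (-v) ^ H.card * Real.exp (-(t * v)) := by
  rw [interpForm_eq_self blk hΔ0, zG_eq_integral_regionLaw]
  haveI := isProbabilityMeasure_regionLaw blk Δ ℱ hΔ ({i} : Finset I) {i}
  have hγ : ∀ j ∈ H, γ j = slotAt cube hcube hi := fun j hj => (eq_slotAt hcube (γ j)).trans (slotAt_congr hcube _ hi (hH j hj))
  have hm : (H.filter fun j => γ j = slotAt cube hcube hi).card = H.card := by
    rw [filter_true_of_mem hγ]
  have hobs : ∀ ω, obs blk (fD (uD χ p ek (slotB (∅ : Finset ι) (univ : Finset I) cube X) (fun b : ↥(∅ : Finset ι) => Φ b)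
      (fun b : ↥(∅ : Finset ι) => c b) (slotY (∅ : Finset ι) (univ : Finset I) cube X) (fun _ : ↥(univ : Finset I) => fun _ : α → ℝ => v) t)
      (cubeIn cube X) γ H) {i} ω = (-v) ^ H.card * Real.exp (-(t * v)) := fun ω => by
    simp only [obs, prod_singleton, fD, filter_cubeIn_eq hcube X i, dif_pos hi, prod_singleton, hm, uD_slotAt]
  simp only [hobs, integral_const, smul_eq_mul, probReal_univ, one_mul]

/-- outside the region the data carry no slot: the one-cube expectation is `1`. [cite: BalabanImbrieJaffe1988, (5.14.3) p.309] -/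
theorem zG_singleton_eq_one (hΔ0 : ∀ x y, blk x ≠ blk y → Δ x y = 0) (hΔ : Δ.PosDef) (hcube : ∀ Y, cube (Sum.inr Y) = Y.1) (Λ X : Finset I)
    {i : I} (hi : i ∉ X) (t : ℝ) {L : Type} [DecidableEq L]
    (γ : L → ↥(slotB (∅ : Finset ι) (univ : Finset I) cube X) ⊕ ↥(slotY (∅ : Finset ι) (univ : Finset I) cube X)) (H : Finset L) :
    zG blk (interpForm blk Δ (corner ℝ Λ)) ℱ (fD (uD χ p ek (slotB (∅ : Finset ι) (univ : Finset I) cube X) (fun b : ↥(∅ : Finset ι) => Φ b)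
        (fun b : ↥(∅ : Finset ι) => c b) (slotY (∅ : Finset ι) (univ : Finset I) cube X) (fun _ : ↥(univ : Finset I) => fun _ : α → ℝ => v) t)
        (cubeIn cube X) γ H) {i} {i} = 1 := by
  rw [interpForm_eq_self blk hΔ0, zG_eq_integral_regionLaw]
  haveI := isProbabilityMeasure_regionLaw blk Δ ℱ hΔ ({i} : Finset I) {i}
  have hobs : ∀ ω, obs blk (fD (uD χ p ek (slotB (∅ : Finset ι) (univ : Finset I) cube X) (fun b : ↥(∅ : Finset ι) => Φ b)
      (fun b : ↥(∅ : Finset ι) => c b) (slotY (∅ : Finset ι) (univ : Finset I) cube X) (fun _ : ↥(univ : Finset I) => fun _ : α → ℝ => v) t)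
      (cubeIn cube X) γ H) {i} ω = 1 := fun ω => by
    simp only [obs, prod_singleton, fD, filter_cubeIn_eq hcube X i, dif_neg hi, prod_empty]
  simp only [hobs, integral_const, smul_eq_mul, probReal_univ, one_mul]

/-! ## §3 The located leaf holds for the data; the unlocated instantiation fails for the same data -/

/-- **NON-VACUITY OF THE LOCATED READING OF (5.14.4) ON GAUSSIAN MODEL DATA**: for the data of §2 (`Δ ≻ 0` block-diagonal, no χ-slots, one
interaction slot per cube with `V ≡ v`, `0 ≤ v ≤ θ ≤ 1`, `β′ ≤ 1`), for every corner `Λ`, region `X`, `t ∈ [0,1]` and assignment `γ`, the leaf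
BY NAME on the located activity holds: polymers with `≥ 2` cubes contribute `0`; a one-cube polymer `{i}` with `m ≥ 1` located derivatives
contributes `(−v)^m e^{−tv}`, bounded by `θ^m`; with none, `e^{−tv} − 1`, bounded by `tv ≤ θ ≤ θ^{β′}`. [cite: BalabanImbrieJaffe1988, (5.14.4) p.309] -/
theorem ineq5144_locAct_witness (hΔ0 : ∀ x y, blk x ≠ blk y → Δ x y = 0) (hΔ : Δ.PosDef) (hcube : ∀ Y, cube (Sum.inr Y) = Y.1)
    {θ β' : ℝ} (hθ0 : 0 < θ) (hθ1 : θ ≤ 1) (hβ1 : β' ≤ 1) (hv0 : 0 ≤ v) (hvθ : v ≤ θ) (Λ X : Finset I) {t : ℝ}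
    (ht : t ∈ Set.Icc (0 : ℝ) 1) {L : Type} [Fintype L] [DecidableEq L]
    (γ : L → ↥(slotB (∅ : Finset ι) (univ : Finset I) cube X) ⊕ ↥(slotY (∅ : Finset ι) (univ : Finset I) cube X)) :
    Ineq5144 (cubeSys I) (Finset L)
      (locAct (cubeIn cube X ∘ γ) (actIn blk Δ ℱ adj χ p ek (∅ : Finset ι) Φ c (univ : Finset I) (fun _ _ => v) cube Λ X t γ))
      Finset.card (fun H (X'' : Finset I) => (X'' \ H.image (cubeIn cube X ∘ γ)).card) θ β' := by
  rw [ineq5144_locAct_iff hθ0]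
  intro H X'' hloc
  have hrhs : 0 ≤ θ ^ ((H.card : ℝ) + β' * ((X'' \ H.image (cubeIn cube X ∘ γ)).card : ℝ)) := Real.rpow_nonneg hθ0.le _
  have hexp1 : Real.exp (-(t * v)) ≤ 1 := Real.exp_le_one_iff.2 (by nlinarith [ht.1])
  have hexp0 : 0 < Real.exp (-(t * v)) := Real.exp_pos _
  by_cases h1 : X''.card = 1
  · -- a one-cube polymer `{i}`
    obtain ⟨i, rfl⟩ := card_eq_one.1 h1
    by_cases hi : i ∈ X
    · have hH : ∀ j ∈ H, cubeIn cube X (γ j) = i := fun j hj => mem_singleton.1 (hloc j hj)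
      have hz := zG_singleton_eq blk ℱ χ p ek Φ c v hΔ0 hΔ hcube Λ X hi t γ H hH
      by_cases hH0 : H = ∅
      · -- no derivative: `|e^{−tv} − 1| ≤ tv ≤ θ ≤ θ^{β′}`
        subst hH0
        simp only [actIn, prime, card_singleton, and_self, if_true, g3, g1_singleton, card_empty, Nat.cast_zero, zero_add, image_empty,
          sdiff_empty, Nat.cast_one, mul_one]
        rw [hz, card_empty, pow_zero, one_mul]
        have hlin : 1 - t * v ≤ Real.exp (-(t * v)) := by linarith [Real.add_one_le_exp (-(t * v))]
        rw [abs_sub_comm, abs_of_nonneg (by linarith)]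
        calc 1 - Real.exp (-(t * v)) ≤ t * v := by linarith
          _ ≤ θ := by nlinarith [ht.2]
          _ = θ ^ (1 : ℝ) := (Real.rpow_one θ).symm
          _ ≤ θ ^ β' := Real.rpow_le_rpow_of_exponent_ge hθ0 hθ1 hβ1
      · -- `m = |H| ≥ 1` derivatives: `|(−v)^m e^{−tv}| ≤ v^m ≤ θ^m`
        have hne : H.Nonempty := nonempty_iff_ne_empty.2 hH0
        have himg : H.image (cubeIn cube X ∘ γ) = {i} := by
          refine eq_singleton_iff_unique_mem.2 ⟨?_, fun x hx => ?_⟩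
          · obtain ⟨j, hj⟩ := hne
            exact mem_image.2 ⟨j, hj, hH j hj⟩
          · obtain ⟨j, hj, rfl⟩ := mem_image.1 hx
            exact hH j hj
        rw [show actIn blk Δ ℱ adj χ p ek (∅ : Finset ι) Φ c (univ : Finset I) (fun _ _ => v) cube Λ X t γ H {i} =
          (-v) ^ H.card * Real.exp (-(t * v)) by
            simp only [actIn, prime, hH0, false_and, if_false, sub_zero, g3, g1_singleton]; exact hz]
        rw [himg, Finset.sdiff_self, card_empty, Nat.cast_zero, mul_zero, add_zero, Real.rpow_natCast, abs_mul, abs_pow, abs_neg,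
          abs_of_nonneg hv0, abs_of_pos hexp0]
        calc v ^ H.card * Real.exp (-(t * v)) ≤ v ^ H.card * 1 := by gcongr
          _ ≤ θ ^ H.card := by rw [mul_one]; exact pow_le_pow_left₀ hv0 hvθ _
    · -- a cube outside the region: no slot there, so `H = ∅` and the activity is `1 − 1 = 0`
      have hH0 : H = ∅ := eq_empty_of_forall_notMem fun j hj => hi (mem_singleton.1 (hloc j hj) ▸ cubeIn_mem cube X (γ j))
      subst hH0
      simp only [actIn, prime, card_singleton, and_self, if_true, g3, g1_singleton]
      rw [zG_singleton_eq_one blk ℱ χ p ek Φ c v hΔ0 hΔ hcube Λ X hi t γ ∅, sub_self, abs_zero]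
      exact hrhs
  · -- no cube or at least two cubes: the activity vanishes
    have h0 : actIn blk Δ ℱ adj χ p ek (∅ : Finset ι) Φ c (univ : Finset I) (fun _ _ => v) cube Λ X t γ H X'' = 0 := by
      simp only [actIn]
      rw [prime_of_not _ (fun h => h1 h.2), g3]
      rcases Nat.lt_or_ge X''.card 1 with hlt | hge
      · rw [card_eq_zero.1 (show X''.card = 0 by omega), g1_empty]
      · exact g1_eq_zero_of_two_le blk ℱ _ adj (fun x y hxy => by rw [interpForm_eq_self blk hΔ0]; exact hΔ0 x y hxy) (by omega)
    rw [h0, abs_zero]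
    exact hrhs

/-- **… WHILE THE UNLOCATED INSTANTIATION OF RECORD FAILS ON THE SAME DATA** (`θ < 1`, a label `l₀`, the region `{i₀}` with any assignment
`γ` of located slots, and a second cube `i₁`): the undecorated expectation of `□_{i₁}` is `1 > θ^{1+β′}` (`BIJ88Ineq5144Located.not_ineq5144_unlocated`).
[cite: BalabanImbrieJaffe1988, (5.14.4) p.309] -/
theorem not_ineq5144_unlocated_witness (hΔ0 : ∀ x y, blk x ≠ blk y → Δ x y = 0) (hΔ : Δ.PosDef) (hcube : ∀ Y, cube (Sum.inr Y) = Y.1)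
    {θ β' : ℝ} (hθ0 : 0 < θ) (hθ1 : θ < 1) (hβ0 : 0 ≤ β') (Λ : Finset I) {i₀ i₁ : I} (hi : i₁ ≠ i₀) (t : ℝ)
    {L : Type} [Fintype L] [DecidableEq L] (l₀ : L)
    (γ : L → ↥(slotB (∅ : Finset ι) (univ : Finset I) cube {i₀}) ⊕ ↥(slotY (∅ : Finset ι) (univ : Finset I) cube {i₀})) :
    ¬ Ineq5144 (cubeSys I) (Finset L) (actIn blk Δ ℱ adj χ p ek (∅ : Finset ι) Φ c (univ : Finset I) (fun _ _ => v) cube Λ {i₀} t γ)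
      Finset.card (fun H (X'' : Finset I) => (X'' \ H.image (cubeIn cube {i₀} ∘ γ)).card) θ β' := by
  refine not_ineq5144_unlocated (j := l₀) (i := i₁) (isSlotLocal_zG blk _ ℱ _ _ fun H i => fD_slot _ _ _ H i) hθ0 hθ1 hβ0
    (fun h => hi (((mem_singleton.1 (cubeIn_mem cube {i₀} (γ l₀))).symm.trans h).symm)) ?_
  rw [zG_singleton_eq_one blk ℱ χ p ek Φ c v hΔ0 hΔ hcube Λ {i₀} (by rwa [mem_singleton]) t γ ∅, abs_one]
  exact hθ1

end Data

end Literature.MathematicalPhysics.QuantumFieldTheory.BalabanImbrieJaffe1984to88.BIJ88Ineq5144LocatedWitness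

end
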